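import Mathlib
import Literature.Geometry.DiscreteGeometry.KissingContactMaximum
import Literature.Barriers.AtomisticToContinuum.LocalizedPotentialsExcludeLennardJones
import HarnessLib

/-!
# Flatley–Theil (2015), Proposition 3.1: the local characterisation of the fcc lattice

Source: L. Flatley, F. Theil, *Face-centered cubic crystallization of atomistic configurations*,
Arch. Ration. Mech. Anal. **218** (2015) 363–416 = arXiv:1407.0692 [cite: FlatleyTheil2015],
§3.1.1, read on the held arXiv text (p. 9 of the lit store copy `paper:arxiv-1407.0692`).
Verbatim:

> **Proposition 3.1.** Let `𝓛′ ⊂ ℝ³` be a set with the property that for each `z ∈ 𝓛′`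
> 1. `|z − z′| ≥ 1` for all `z′ ∈ 𝓛′ ∖ {z}`.
> 2. There are exactly 12 points `z′ ∈ 𝓛′` such that `|z − z′| = 1`.
> 3. There are exactly 48 pairs `z₁, z₂ ∈ 𝓛′` such that `|z₁ − z₂| = |z − zᵢ| = 1` for
>    `i ∈ {1, 2}`.
> 4. There are exactly 48 pairs `z₁, z₂ ∈ 𝓛′` such that `|z₁ − z₂| = √3` and `|zᵢ − z| = 1`
>    for `i ∈ {1, 2}`.
>
> Then there exists a translation `t ∈ ℝ³` and a rotation `R ∈ SO(3)` such that
> `R 𝓛′ + t = 𝓛_fcc`.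
>
> *Proof.* Properties 1–3 are sufficient to ensure that, for every `z ∈ 𝓛′`, the set
> `(𝕊 + z) ∩ 𝓛′` is either a rotated and translated cuboctahedron, or a twisted cuboctahedron;
> this is a consequence of Theorem 3.5. Property 4 then selects the cuboctahedron. By induction
> one can see that each cuboctahedron is a translated copy of a single rotated cuboctahedron,
> i.e. there exists a translation `t ∈ ℝ³` and a rotation `R ∈ SO(3)` such that
> `(𝕊 + z) ∩ 𝓛′ = R Cub + t` for all `z ∈ 𝓛′`, which concludes the proof. □

(`𝓛_fcc = (b₁ b₂ b₃) ℤ³`, `b₁ = (0,1,1)ᵀ/√2`, `b₂ = (1,0,1)ᵀ/√2`, `b₃ = (1,1,0)ᵀ/√2`, §1 p. 3 —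
the tree's `fccPoint` / `fccLattice` of
`Literature/Barriers/AtomisticToContinuum/LocalizedPotentialsExcludeLennardJones.lean`;
`Cub := 𝓛_fcc ∩ 𝕊`, the cuboctahedron — the tree's `fccKissingPattern`; the twisted cuboctahedron
`TCub := 𝓛_hcp ∩ 𝕊` — the tree's `hcpKissingPattern` (`Literature/Geometry/DiscreteGeometry/
KissingPatterns.lean`). "Pairs" in 3 and 4 are ORDERED pairs: the cuboctahedron has `24`
unordered = `48` ordered unit edges, and `48` ordered vertex pairs at distance `√3`.)

## What is proved here

`FlatleyTheil2015_prop31`: the proposition AS PRINTED, for NON-EMPTY `𝓛′` (print note below),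
rendered with `𝓛′ : Set ℝ³`, hypothesis 2 as `Set.ncard {z′ ∈ 𝓛′ | dist z z′ = 1} = 12`,
hypotheses 3–4 as `Set.ncard` of the sets of ordered pairs `(z₁, z₂) ∈ 𝓛′ × 𝓛′` with the printed
distance conditions, and the conclusion with `R : ℝ³ ≃ₗᵢ[ℝ] ℝ³` of determinant `1` (`SO(3)`) and
`t : ℝ³` such that `(z ↦ R z + t) '' 𝓛′ = fccLattice`. The ONE external input of the printed proof,
Theorem 3.5 (= Flatley–Tarasov–Taylor–Theil 2013, Theorem 4: twelve kissing balls touch each other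
at most `24` times, with equality only for the (twisted) cuboctahedron; computer-assisted in print),
enters exactly as in print, as the hypothesis `(h35 : FlatleyEtAl2013_maxContacts)` — the tree's
named fact of `Literature/Geometry/DiscreteGeometry/KissingContactMaximum.lean` (undischarged; so
this theorem is conditional on that named fact and on nothing else). Also the lattice form
`FlatleyTheil2015.eq_image_fccLattice_of_localShells` (`𝓛′ = z₀ + A 𝓛_fcc` for any base point
`z₀ ∈ 𝓛′` and some linear isometry `A`), and the covering lemma `exists_dist_fccPoint_lt_one`
(every point of `ℝ³` is within distance `< 1` of `𝓛_fcc`). Non-vacuity (v2 append):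
`fccLattice_prop31_hypotheses` — `𝓛_fcc` itself is non-empty and satisfies hypotheses 1–4 (so the
hypotheses of the proposition describe exactly the rigid motions of `𝓛_fcc`), with
`one_le_dist_fccLattice` (a non-zero vector of `D₃` has squared norm `≥ 2`) and
`nbr_fccLattice_eq` (the unit neighbours of a lattice point are `z + Cub`: the integer vectors of
squared norm `2` are the twelve minimal vectors of `D₃`).

## The proof, following the print and filling in "by induction"

* Step 1 (print: "consequence of Theorem 3.5" + "Property 4 selects the cuboctahedron"): for
  `z ∈ 𝓛′` the translated shell `Z = {z′ − z : z′ ∈ 𝓛′, |z − z′| = 1}` is a finite set of unit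
  vectors (hyp. 2), pairwise `≥ 1` apart (hyp. 1), with `48` ordered contact pairs (hyp. 3), so by
  `h35` it is `A · Cub` or `A · TCub` for a linear isometry `A`; `TCub` has `36`, not `48`, ordered
  vertex pairs at distance `√3` (`card_hcpInt_sqrt3`, kernel arithmetic on the integer model
  `hcpInt`), so hyp. 4 excludes it (`shell_eq_image`).
* Step 2 (print: "by induction … each cuboctahedron is a translated copy of a single rotated
  cuboctahedron"), made precise as: ADJACENT points have the SAME cuboctahedron (`good_step`). If
  `z′ = z + A e` with `e ∈ Cub`, pick `f, g ∈ Cub` forming a unit triangle with `e` (every vertex of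
  the cuboctahedron lies on a triangular face, `exists_triangle_fccInt`); then `z`, `z + A f`,
  `z + A g` are unit neighbours of `z′`, so the shell `A′ · Cub` of `z′` contains the unit triangle
  `A(−e), A(f − e), A(g − e)`. A cuboctahedron is generated by any of its unit triangles
  `(u, v, w)` as `{±u, ±v, ±w, ±(u − v), ±(v − w), ±(w − u)}` (`genInt_eq_fccInt`, kernel check of
  the `48` ordered triangles of the integer model `fccInt`), and the triangle `(−e, f − e, g − e)`
  generates the same twelve vectors as `(e, f, g)` (`genInt_shift_eq_fccInt`); hence
  `A′ · Cub = A · Cub` (`image_eq_of_triangle`). Consequently `z₀ + A x ∈ 𝓛′` for every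
  `x ∈ 𝓛_fcc`, by induction along `x = a₀ b₁ + a₁ b₂ + a₂ b₃` with `bᵢ ∈ Cub` (`good_lattice`).
* Step 3 (not addressed in print: why `𝓛′` has no second component): every point of `ℝ³` is
  within distance `< 1` of `z₀ + A 𝓛_fcc` (`exists_dist_fccPoint_lt_one`: round `√2·s`
  coordinatewise to `ℤ³` and repair the parity of the coordinate sum, error `≤ √(3/4)`), so by
  hyp. 1 every `z ∈ 𝓛′` already lies in `z₀ + A 𝓛_fcc`. Finally `A` may be taken orientation
  preserving because `𝓛_fcc = −𝓛_fcc` (`eq_image_fccLattice_det_one`), and `R := A⁻¹`,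
  `t := −A⁻¹ z₀`.

## Print notes (lit-1, 2026-08-24)

* As printed the proposition is false for `𝓛′ = ∅` (hypotheses 1–4 hold vacuously, `R ∅ + t = ∅ ≠
  𝓛_fcc`): `FlatleyTheil2015_prop31` carries `𝓛′.Nonempty`; see `prop31_needs_nonempty`.
* Hypothesis 2 is implied by 1 and 3 given Theorem 3.5 and the kissing number (an arrangement with
  `24` contacts has exactly twelve balls, `FlatleyEtAl2013_maxContacts.card_eq_twelve`); it is kept
  because it is printed (and it is what makes the shells finite without a compactness argument).
* The printed "by induction" does not mention that two far-apart rotated copies of `𝓛_fcc` must be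
  excluded; hypothesis 1 does exclude them (Step 3), so the statement is correct as printed.

Not here: Proposition 3.3 (the `α`-perturbed version, by compactness), Theorem 3.5 itself
(`FlatleyEtAl2013_maxContacts`, computer-assisted), Corollary 1.3.
-/

noncomputable section

open Literature.Geometry.DiscreteGeometry Finset
open Literature.Barriers.AtomisticToContinuum.FlatleyTheil2015

namespace Literature.MathematicalPhysics.StatisticalMechanics.FlatleyTheil2015

/-! ### The integer model of the cuboctahedron: three kernel checks -/

/-- The twelve vectors `{±u, ±v, ±w, ±(u − v), ±(v − w), ±(w − u)}` generated by a triangle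
`(u, v, w)` of `ℤ³`.
[cite: FlatleyTheil2015, Proposition 3.1 (proof, "a single rotated cuboctahedron"); our device] -/
private def genInt (u v w : Fin 3 → ℤ) : Finset (Fin 3 → ℤ) :=
  {u, v, w, -u, -v, -w, u - v, v - w, w - u, v - u, w - v, u - w}

/-- Every unit triangle of the cuboctahedron `fccInt` (integer model, squared edge length `2`)
generates all twelve of its vertices.
[cite: FlatleyTheil2015, Proposition 3.1 (proof); our lemma, kernel check] -/
private theorem genInt_eq_fccInt :
    ∀ u ∈ fccInt, ∀ v ∈ fccInt, sqNormInt (u - v) = 2 → ∀ w ∈ fccInt,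
      sqNormInt (v - w) = 2 → sqNormInt (u - w) = 2 → genInt u v w = fccInt := by
  decide

/-- For a unit triangle `(u, v, w)` of `fccInt`, the triangle `(−u, v − u, w − u)` (the same
triangle seen from the neighbouring vertex `u`) generates `fccInt` as well.
[cite: FlatleyTheil2015, Proposition 3.1 (proof); our lemma, kernel check] -/
private theorem genInt_shift_eq_fccInt :
    ∀ u ∈ fccInt, ∀ v ∈ fccInt, sqNormInt (u - v) = 2 → ∀ w ∈ fccInt,
      sqNormInt (v - w) = 2 → sqNormInt (u - w) = 2 → genInt (-u) (v - u) (w - u) = fccInt := by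
  decide

/-- Every vertex of the cuboctahedron lies on a triangular face. [folklore] -/
private theorem exists_triangle_fccInt :
    ∀ u ∈ fccInt, ∃ v ∈ fccInt, ∃ w ∈ fccInt,
      sqNormInt (u - v) = 2 ∧ sqNormInt (v - w) = 2 ∧ sqNormInt (u - w) = 2 := by
  decide

/-- The cuboctahedron is centrally symmetric. [folklore] -/
private theorem neg_mem_fccInt : ∀ u ∈ fccInt, -u ∈ fccInt := by decide

/-- Flatley–Theil's generators `b₁, b₂, b₃` of `𝓛_fcc` (times `√2`) are vertices of the
cuboctahedron. [cite: FlatleyTheil2015, §1 (arXiv p. 3), definition of 𝓛_fcc] -/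
private theorem basis_mem_fccInt :
    (![0, 1, 1] : Fin 3 → ℤ) ∈ fccInt ∧ (![1, 0, 1] : Fin 3 → ℤ) ∈ fccInt ∧
      (![1, 1, 0] : Fin 3 → ℤ) ∈ fccInt := by
  decide

/-- The twisted cuboctahedron has `36` (not `48`) ordered vertex pairs at distance `√3`: in the
integer model `hcpInt` (squared norms `18`) these are the pairs at squared distance `54`.
[cite: FlatleyTheil2015, Proposition 3.1 (4) ("Property 4 then selects the cuboctahedron");
our lemma, kernel check] -/
private theorem card_hcpInt_sqrt3 :
    ((hcpInt ×ˢ hcpInt).filter fun p => sqNormInt (p.1 - p.2) = 54).card = 36 := by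
  decide

/-! ### The scaled integer embedding composed with a linear isometry -/

/-- `sqNormInt v ≥ 0`. [folklore] -/
private theorem sqNormInt_nonneg (v : Fin 3 → ℤ) : 0 ≤ sqNormInt v := by
  unfold sqNormInt; positivity

/-- `sqNormInt (−v) = sqNormInt v`. [folklore] -/
private theorem sqNormInt_neg (v : Fin 3 → ℤ) : sqNormInt (-v) = sqNormInt v := by
  simp [sqNormInt]

/-- `intVec` is additive. [folklore] -/
private theorem intVec_add (v w : Fin 3 → ℤ) : intVec (v + w) = intVec v + intVec w := by
  ext i; simp [intVec]

/-- `v ↦ A (v/√N)`, the scaled integer embedding `ℤ³ → ℝ³` followed by a linear isometry `A`, as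
an additive map (for `N = 2` its image of `fccInt` is the cuboctahedron `A · Cub`). [folklore] -/
private def phiN (A : Space →ₗᵢ[ℝ] Space) (N : ℕ) : (Fin 3 → ℤ) →+ Space where
  toFun v := A ((Real.sqrt N)⁻¹ • intVec v)
  map_zero' := by
    have : intVec 0 = 0 := by ext i; simp [intVec]
    simp [this]
  map_add' v w := by
    rw [intVec_add, smul_add, map_add]

/-- Unfolding `phiN`. [folklore] -/
private theorem phiN_apply (A : Space →ₗᵢ[ℝ] Space) (N : ℕ) (v : Fin 3 → ℤ) :
    phiN A N v = A ((Real.sqrt N)⁻¹ • intVec v) := rfl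

/-- `A · scaledPattern S N = phiN A N '' S`. [folklore] -/
private theorem image_scaledPattern (A : Space →ₗᵢ[ℝ] Space) (S : Finset (Fin 3 → ℤ)) (N : ℕ) :
    (scaledPattern S N).image A = S.image (phiN A N) := by
  rw [scaledPattern, Finset.image_image]
  rfl

/-- Distances in the image: `dist (A(v/√N)) (A(w/√N)) = √(|v − w|²/N)`. [folklore] -/
private theorem dist_phiN (A : Space →ₗᵢ[ℝ] Space) {N : ℕ} (hN : N ≠ 0) (v w : Fin 3 → ℤ) :
    dist (phiN A N v) (phiN A N w) = Real.sqrt ((sqNormInt (v - w) : ℝ) / N) := by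
  have hpos : (0 : ℝ) < Real.sqrt N := by positivity
  rw [phiN_apply, phiN_apply, dist_eq_norm, ← map_sub, A.norm_map, ← smul_sub, intVec_sub,
    norm_smul, norm_inv, Real.norm_of_nonneg hpos.le, norm_intVec,
    Real.sqrt_div' _ (Nat.cast_nonneg N), div_eq_inv_mul]

/-- `dist (A(v/√N)) (A(w/√N)) = d ↔ |v − w|² = N d²` (`d ≥ 0`). [folklore] -/
private theorem dist_phiN_eq_iff (A : Space →ₗᵢ[ℝ] Space) {N : ℕ} (hN : N ≠ 0) (v w : Fin 3 → ℤ)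
    {d : ℝ} (hd : 0 ≤ d) :
    dist (phiN A N v) (phiN A N w) = d ↔ (sqNormInt (v - w) : ℝ) = N * d ^ 2 := by
  have hNpos : (0 : ℝ) < N := by positivity
  have h0 : (0 : ℝ) ≤ (sqNormInt (v - w) : ℝ) / N := by
    have := sqNormInt_nonneg (v - w); positivity
  rw [dist_phiN A hN, Real.sqrt_eq_iff_eq_sq h0 hd, div_eq_iff hNpos.ne', mul_comm]

/-- Counting ordered pairs at a prescribed distance `d` in `A · scaledPattern S N` = counting
ordered pairs of `S` at squared integer distance `N d²`. [folklore] -/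
private theorem card_filter_dist_image (A : Space →ₗᵢ[ℝ] Space) (S : Finset (Fin 3 → ℤ)) {N : ℕ}
    (hN : N ≠ 0) {d : ℝ} (hd : 0 ≤ d)
    [DecidablePred fun p : Space × Space => dist p.1 p.2 = d] :
    (((S.image (phiN A N)) ×ˢ (S.image (phiN A N))).filter fun p => dist p.1 p.2 = d).card =
      ((S ×ˢ S).filter fun p => (sqNormInt (p.1 - p.2) : ℝ) = N * d ^ 2).card := by
  symm
  refine Finset.card_bij (fun p _ => (phiN A N p.1, phiN A N p.2)) ?_ ?_ ?_
  · intro p hp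
    simp only [Finset.mem_filter, Finset.mem_product] at hp ⊢
    exact ⟨⟨Finset.mem_image_of_mem _ hp.1.1, Finset.mem_image_of_mem _ hp.1.2⟩,
      (dist_phiN_eq_iff A hN _ _ hd).2 hp.2⟩
  · intro p hp q hq hpq
    simp only [Prod.mk.injEq] at hpq
    have hinj : Function.Injective (phiN A N) := fun a b hab => by
      have := (scaledPattern_map_injective (N := N) hN) (A.injective hab)
      exact this
    exact Prod.ext (hinj hpq.1) (hinj hpq.2)
  · intro q hq
    simp only [Finset.mem_filter, Finset.mem_product, Finset.mem_image] at hq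
    obtain ⟨⟨⟨v, hv, hv'⟩, ⟨w, hw, hw'⟩⟩, hq⟩ := hq
    refine ⟨(v, w), ?_, ?_⟩
    · simp only [Finset.mem_filter, Finset.mem_product]
      refine ⟨⟨hv, hw⟩, (dist_phiN_eq_iff A hN v w hd).1 ?_⟩
      rw [hv', hw']; exact hq
    · simp [hv', hw']


/-! ### Two cuboctahedra sharing a unit triangle coincide -/

/-- The twelve vectors `{±x, ±y, ±w, ±(x − y), ±(y − w), ±(w − x)}` of `ℝ³`. [folklore] -/
private def genFin (x y w : Space) : Finset Space :=
  {x, y, w, -x, -y, -w, x - y, y - w, w - x, y - x, w - y, x - w}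

/-- `genInt` is mapped to `genFin` by additive maps. [folklore] -/
private theorem image_genInt (Φ : (Fin 3 → ℤ) →+ Space) (u v w : Fin 3 → ℤ) :
    (genInt u v w).image Φ = genFin (Φ u) (Φ v) (Φ w) := by
  simp only [genInt, genFin, Finset.image_insert, Finset.image_singleton, map_neg, map_sub]

/-- **Two cuboctahedra which share a unit triangle coincide**: if `e, f, g` is a unit triangle of
`Cub` and the cuboctahedron `A′ · Cub` contains the three vectors `A(−e)`, `A(f − e)`, `A(g − e)`
(a unit triangle of `A · Cub`), then `A′ · Cub = A · Cub`. This is the content of the printed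
"each cuboctahedron is a translated copy of a single rotated cuboctahedron".
[cite: FlatleyTheil2015, Proposition 3.1 (proof); our lemma] -/
private theorem image_eq_of_triangle {A A' : Space →ₗᵢ[ℝ] Space} {e f g : Fin 3 → ℤ}
    (he : e ∈ fccInt) (hf : f ∈ fccInt) (hg : g ∈ fccInt) (hef : sqNormInt (e - f) = 2)
    (hfg : sqNormInt (f - g) = 2) (heg : sqNormInt (e - g) = 2)
    (h₁ : phiN A 2 (-e) ∈ fccInt.image (phiN A' 2))
    (h₂ : phiN A 2 (f - e) ∈ fccInt.image (phiN A' 2))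
    (h₃ : phiN A 2 (g - e) ∈ fccInt.image (phiN A' 2)) :
    fccInt.image (phiN A' 2) = fccInt.image (phiN A 2) := by
  obtain ⟨a, ha, hae⟩ := Finset.mem_image.1 h₁
  obtain ⟨b, hb, hbe⟩ := Finset.mem_image.1 h₂
  obtain ⟨c, hc, hce⟩ := Finset.mem_image.1 h₃
  have two : (2 : ℕ) ≠ 0 := by norm_num
  have key : ∀ {p q : Fin 3 → ℤ} {r s : Fin 3 → ℤ}, phiN A' 2 p = phiN A 2 r →
      phiN A' 2 q = phiN A 2 s → sqNormInt (r - s) = 2 → sqNormInt (p - q) = 2 := by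
    intro p q r s hp hq hrs
    have h1 : dist (phiN A 2 r) (phiN A 2 s) = 1 := by
      rw [dist_phiN_eq_iff A two r s zero_le_one]; push_cast; rw [hrs]; norm_num
    rw [← hp, ← hq, dist_phiN_eq_iff A' two p q zero_le_one] at h1
    have : (sqNormInt (p - q) : ℝ) = 2 := by rw [h1]; norm_num
    exact_mod_cast this
  have hab : sqNormInt (a - b) = 2 := key hae hbe (by
    have : -e - (f - e) = -f := by abel
    rw [this, sqNormInt_neg, sqNormInt_fccInt f hf]; rfl)
  have hbc : sqNormInt (b - c) = 2 := key hbe hce (by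
    have : f - e - (g - e) = f - g := by abel
    rw [this, hfg])
  have hac : sqNormInt (a - c) = 2 := key hae hce (by
    have : -e - (g - e) = -g := by abel
    rw [this, sqNormInt_neg, sqNormInt_fccInt g hg]; rfl)
  calc fccInt.image (phiN A' 2)
      = (genInt a b c).image (phiN A' 2) := by rw [genInt_eq_fccInt a ha b hb hab c hc hbc hac]
    _ = genFin (phiN A' 2 a) (phiN A' 2 b) (phiN A' 2 c) := image_genInt _ _ _ _
    _ = genFin (phiN A 2 (-e)) (phiN A 2 (f - e)) (phiN A 2 (g - e)) := by rw [hae, hbe, hce]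
    _ = (genInt (-e) (f - e) (g - e)).image (phiN A 2) := (image_genInt _ _ _ _).symm
    _ = fccInt.image (phiN A 2) := by rw [genInt_shift_eq_fccInt e he f hf hef g hg hfg heg]


/-! ### Shells of a set satisfying hypotheses 1–4 -/

/-- The unit neighbours `{z′ ∈ 𝓛′ : |z − z′| = 1}` of `z` (hypothesis 2 of Proposition 3.1 says
there are exactly twelve). [cite: FlatleyTheil2015, Proposition 3.1 (2)] -/
def nbr (L' : Set Space) (z : Space) : Set Space := {z' | z' ∈ L' ∧ dist z z' = 1}

section Shells

variable {L' : Set Space}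
variable (h1 : ∀ z ∈ L', ∀ z' ∈ L', z ≠ z' → 1 ≤ dist z z')
  (h2 : ∀ z ∈ L', (nbr L' z).ncard = 12)
  (h3 : ∀ z ∈ L', {p : Space × Space | p.1 ∈ L' ∧ p.2 ∈ L' ∧ dist p.1 p.2 = 1 ∧
      dist z p.1 = 1 ∧ dist z p.2 = 1}.ncard = 48)
  (h4 : ∀ z ∈ L', {p : Space × Space | p.1 ∈ L' ∧ p.2 ∈ L' ∧ dist p.1 p.2 = Real.sqrt 3 ∧
      dist z p.1 = 1 ∧ dist z p.2 = 1}.ncard = 48)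

/-- A set of `ncard` twelve is finite. [folklore] -/
private theorem nbr_finite {z : Space} (hz : (nbr L' z).ncard = 12) : (nbr L' z).Finite :=
  Set.finite_of_ncard_ne_zero (by rw [hz]; norm_num)

/-- The shell `(𝕊 + z) ∩ 𝓛′` of `z`, translated to the origin, as a `Finset` of `ℝ³`.
[cite: FlatleyTheil2015, Proposition 3.1 (proof, "the set (𝕊 + z) ∩ 𝓛′")] -/
private def shell (L' : Set Space) (z : Space) (hfin : (nbr L' z).Finite) : Finset Space :=
  hfin.toFinset.image fun x => x - z

/-- Membership in the translated shell. [folklore] -/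
private theorem mem_shell {z : Space} (hfin : (nbr L' z).Finite) {x : Space} :
    x ∈ shell L' z hfin ↔ z + x ∈ L' ∧ dist z (z + x) = 1 := by
  simp only [shell, Finset.mem_image, Set.Finite.mem_toFinset, nbr, Set.mem_setOf_eq]
  constructor
  · rintro ⟨x', ⟨hx', hd⟩, rfl⟩
    rw [add_sub_cancel]; exact ⟨hx', hd⟩
  · intro h
    exact ⟨z + x, h, by abel⟩

/-- The translated shell consists of unit vectors. [folklore] -/
private theorem norm_of_mem_shell {z : Space} (hfin : (nbr L' z).Finite) {x : Space}
    (hx : x ∈ shell L' z hfin) : ‖x‖ = 1 := by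
  rw [mem_shell] at hx
  have := hx.2
  rwa [dist_eq_norm', add_sub_cancel_left] at this

include h1 in
/-- By hypothesis 1 the translated shell is `1`-separated.
[cite: FlatleyTheil2015, Proposition 3.1 (1)] -/
private theorem one_le_dist_of_mem_shell {z : Space} (hfin : (nbr L' z).Finite) {x y : Space}
    (hx : x ∈ shell L' z hfin) (hy : y ∈ shell L' z hfin) (hxy : x ≠ y) : 1 ≤ dist x y := by
  rw [mem_shell] at hx hy
  have h := h1 _ hx.1 _ hy.1 (fun h => hxy (add_left_cancel h))
  rwa [dist_add_left] at h

/-- Ordered pairs of the translated shell at distance `d` ↔ ordered pairs of unit neighbours of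
`z` in `𝓛′` at distance `d` (the sets counted by hypotheses 3 and 4). [folklore] -/
private theorem card_shell_pairs {z : Space} (hfin : (nbr L' z).Finite) (d : ℝ)
    [DecidablePred fun p : Space × Space => dist p.1 p.2 = d] :
    (((shell L' z hfin) ×ˢ (shell L' z hfin)).filter fun p => dist p.1 p.2 = d).card =
      {p : Space × Space | p.1 ∈ L' ∧ p.2 ∈ L' ∧ dist p.1 p.2 = d ∧
        dist z p.1 = 1 ∧ dist z p.2 = 1}.ncard := by
  classical
  have hset : {p : Space × Space | p.1 ∈ L' ∧ p.2 ∈ L' ∧ dist p.1 p.2 = d ∧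
        dist z p.1 = 1 ∧ dist z p.2 = 1} =
      ↑((hfin.toFinset ×ˢ hfin.toFinset).filter fun p => dist p.1 p.2 = d) := by
    ext p
    simp only [Set.mem_setOf_eq, Finset.coe_filter, Finset.mem_product, Set.Finite.mem_toFinset,
      nbr]
    tauto
  rw [hset, Set.ncard_coe_finset]
  symm
  refine Finset.card_bij (fun p _ => (p.1 - z, p.2 - z)) ?_ ?_ ?_
  · intro p hp
    simp only [Finset.mem_filter, Finset.mem_product, Set.Finite.mem_toFinset, nbr,
      Set.mem_setOf_eq] at hp
    simp only [Finset.mem_filter, Finset.mem_product, mem_shell, add_sub_cancel]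
    refine ⟨⟨⟨hp.1.1.1, hp.1.1.2⟩, hp.1.2.1, hp.1.2.2⟩, ?_⟩
    rw [dist_sub_right]
    convert hp.2
  · intro p hp q hq hpq
    simp only [Prod.mk.injEq, sub_left_inj] at hpq
    exact Prod.ext hpq.1 hpq.2
  · intro q hq
    refine ⟨(q.1 + z, q.2 + z), ?_, by simp⟩
    simp only [Finset.mem_filter, Finset.mem_product, mem_shell] at hq
    simp only [Finset.mem_filter, Finset.mem_product, Set.Finite.mem_toFinset, nbr,
      Set.mem_setOf_eq]
    obtain ⟨⟨hq1, hq2⟩, hd⟩ := hq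
    rw [add_comm q.1, add_comm q.2]
    refine ⟨⟨hq1, hq2⟩, ?_⟩
    rw [dist_add_left]
    convert hd

include h1 h2 h3 h4 in
/-- **Step 1 of the printed proof: every shell is a cuboctahedron** ("Properties 1–3 are
sufficient to ensure that … (𝕊 + z) ∩ 𝓛′ is either a rotated and translated cuboctahedron, or a
twisted cuboctahedron; this is a consequence of Theorem 3.5. Property 4 then selects the
cuboctahedron."): with Theorem 3.5 as the hypothesis `h35`, the translated shell of `z ∈ 𝓛′` is
`A · Cub = phiN A 2 '' fccInt` for a linear isometry `A`; the twisted cuboctahedron is excluded by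
hypothesis 4 because it has only `36` ordered `√3`-pairs (`card_hcpInt_sqrt3`).
[cite: FlatleyTheil2015, Proposition 3.1 (proof, first two sentences)] -/
private theorem shell_eq_image (h35 : FlatleyEtAl2013_maxContacts) {z : Space} (hz : z ∈ L') :
    ∃ A : Space →ₗᵢ[ℝ] Space, shell L' z (nbr_finite (h2 z hz)) = fccInt.image (phiN A 2) := by
  classical
  set Z := shell L' z (nbr_finite (h2 z hz)) with hZ
  have hn : ∀ x ∈ Z, ‖x‖ = 1 := fun x hx => norm_of_mem_shell _ hx
  have hsep : ∀ x ∈ Z, ∀ y ∈ Z, x ≠ y → 1 ≤ dist x y :=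
    fun x hx y hy hxy => one_le_dist_of_mem_shell h1 _ hx hy hxy
  have h48 : ((Z ×ˢ Z).filter fun p => dist p.1 p.2 = 1).card = 48 := by
    rw [hZ, card_shell_pairs, h3 z hz]
  obtain ⟨-, hcase⟩ := h35 Z hn hsep
  obtain ⟨A, hA | hA⟩ := hcase h48
  · exact ⟨A, by rw [hA, fccKissingPattern, image_scaledPattern]⟩
  · exfalso
    have h4' : ((Z ×ˢ Z).filter fun p => dist p.1 p.2 = Real.sqrt 3).card = 48 := by
      rw [hZ, card_shell_pairs, h4 z hz]
    rw [hA, hcpKissingPattern, image_scaledPattern,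
      card_filter_dist_image A hcpInt (by norm_num) (Real.sqrt_nonneg 3)] at h4'
    have h36 : ((hcpInt ×ˢ hcpInt).filter fun p : (Fin 3 → ℤ) × (Fin 3 → ℤ) =>
        (sqNormInt (p.1 - p.2) : ℝ) = (18 : ℕ) * Real.sqrt 3 ^ 2).card = 36 := by
      rw [← card_hcpInt_sqrt3]
      congr 1
      refine Finset.filter_congr fun p _ => ?_
      rw [Real.sq_sqrt (by norm_num : (0 : ℝ) ≤ 3)]
      norm_cast
    omega

include h1 h2 h3 h4 in
/-- Step 1 restated in `𝓛′`: the unit neighbours of `z ∈ 𝓛′` are `z + A · Cub`.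
[cite: FlatleyTheil2015, Proposition 3.1 (proof)] -/
private theorem nbr_eq_image (h35 : FlatleyEtAl2013_maxContacts) {z : Space} (hz : z ∈ L') :
    ∃ A : Space →ₗᵢ[ℝ] Space, nbr L' z = (fun v => z + phiN A 2 v) '' ↑fccInt := by
  obtain ⟨A, hA⟩ := shell_eq_image h1 h2 h3 h4 h35 hz
  refine ⟨A, Set.ext fun x => ?_⟩
  have hx : x ∈ nbr L' z ↔ x - z ∈ shell L' z (nbr_finite (h2 z hz)) := by
    rw [mem_shell, add_sub_cancel]; rfl
  rw [hx, hA]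
  simp only [Finset.mem_coe, Finset.mem_image, Set.mem_image]
  constructor
  · rintro ⟨v, hv, hvx⟩; exact ⟨v, hv, by rw [hvx]; abel⟩
  · rintro ⟨v, hv, hvx⟩; exact ⟨v, hv, by rw [← hvx]; abel⟩

/-- `z` is a point of `𝓛′` whose unit neighbours are `z + A · Cub` (the induction hypothesis of
the printed "by induction"). [cite: FlatleyTheil2015, Proposition 3.1 (proof)] -/
private def Good (L' : Set Space) (A : Space →ₗᵢ[ℝ] Space) (z : Space) : Prop :=
  z ∈ L' ∧ nbr L' z = (fun v => z + phiN A 2 v) '' ↑fccInt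

include h1 h2 h3 h4 in
/-- **Step 2 of the printed proof ("By induction one can see that each cuboctahedron is a
translated copy of a single rotated cuboctahedron"), the induction step**: if the unit neighbours
of `z` are `z + A · Cub` and `p ∈ Cub`, then `z + A p ∈ 𝓛′` and ITS unit neighbours are
`(z + A p) + A · Cub` — the two cuboctahedra share the unit triangle `A(−p), A(f − p), A(g − p)`
(`image_eq_of_triangle`). [cite: FlatleyTheil2015, Proposition 3.1 (proof, "by induction")] -/
private theorem good_step (h35 : FlatleyEtAl2013_maxContacts) {A : Space →ₗᵢ[ℝ] Space} {z : Space}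
    (hg : Good L' A z) {p : Fin 3 → ℤ} (hp : p ∈ fccInt) : Good L' A (z + phiN A 2 p) := by
  have two : (2 : ℕ) ≠ 0 := by norm_num
  set z' := z + phiN A 2 p with hz'
  have hz'n : z' ∈ nbr L' z := by rw [hg.2]; exact ⟨p, hp, rfl⟩
  obtain ⟨hz'L, hdzz'⟩ := hz'n
  obtain ⟨A', hA'⟩ := nbr_eq_image h1 h2 h3 h4 h35 hz'L
  refine ⟨hz'L, ?_⟩
  obtain ⟨f, hf, g, hg', hpf, hfg, hpg⟩ := exists_triangle_fccInt p hp
  -- three points of the shell of z'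
  have mem_nbr' : ∀ {x : Space}, x ∈ L' → dist z' x = 1 → ∃ a ∈ fccInt, phiN A' 2 a = x - z' := by
    intro x hx hd
    have : x ∈ nbr L' z' := ⟨hx, hd⟩
    rw [hA'] at this
    obtain ⟨a, ha, hax⟩ := this
    exact ⟨a, ha, by simp only at hax; rw [← hax]; abel⟩
  have h₁ : phiN A 2 (-p) ∈ fccInt.image (phiN A' 2) := by
    obtain ⟨a, ha, hax⟩ := mem_nbr' hg.1 (by rw [dist_comm]; exact hdzz')
    exact Finset.mem_image.2 ⟨a, ha, by rw [hax, map_neg, hz']; abel⟩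
  have hmem : ∀ {q : Fin 3 → ℤ}, q ∈ fccInt → sqNormInt (p - q) = 2 →
      phiN A 2 (q - p) ∈ fccInt.image (phiN A' 2) := by
    intro q hq hpq
    have hqn : z + phiN A 2 q ∈ nbr L' z := by rw [hg.2]; exact ⟨q, hq, rfl⟩
    have hd : dist z' (z + phiN A 2 q) = 1 := by
      rw [hz', dist_add_left, dist_phiN_eq_iff A two p q zero_le_one]
      push_cast; rw [hpq]; norm_num
    obtain ⟨a, ha, hax⟩ := mem_nbr' hqn.1 hd
    exact Finset.mem_image.2 ⟨a, ha, by rw [hax, map_sub, hz']; abel⟩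
  have key := image_eq_of_triangle hp hf hg' hpf hfg hpg h₁ (hmem hf hpf) (hmem hg' hpg)
  rw [hA']
  have : (fun v => z' + phiN A' 2 v) '' ↑fccInt =
      (fun x => z' + x) '' ↑(fccInt.image (phiN A' 2)) := by
    rw [Finset.coe_image, Set.image_image]
  rw [this, key, Finset.coe_image, Set.image_image]

include h1 h2 h3 h4 in
/-- Iterating the induction step along a lattice direction `p ∈ Cub` (both signs).
[cite: FlatleyTheil2015, Proposition 3.1 (proof, "by induction")] -/
private theorem good_zsmul (h35 : FlatleyEtAl2013_maxContacts) {A : Space →ₗᵢ[ℝ] Space} {z : Space}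
    (hg : Good L' A z) {p : Fin 3 → ℤ} (hp : p ∈ fccInt) (n : ℤ) :
    Good L' A (z + phiN A 2 (n • p)) := by
  induction n using Int.induction_on with
  | zero => simpa using hg
  | succ k ih =>
    have := good_step h1 h2 h3 h4 h35 ih hp
    rwa [add_assoc, ← map_add, ← add_one_zsmul] at this
  | pred k ih =>
    have := good_step h1 h2 h3 h4 h35 ih (neg_mem_fccInt p hp)
    rw [add_assoc, ← map_add, ← sub_eq_add_neg] at this
    rwa [sub_smul, one_smul]

/-- `A (a₀ b₁ + a₁ b₂ + a₂ b₃) = phiN A 2 (a₀ (0,1,1) + a₁ (1,0,1) + a₂ (1,1,0))`: Flatley–Theil's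
generators in the integer model. [cite: FlatleyTheil2015, §1 (arXiv p. 3), definition of 𝓛_fcc] -/
private theorem fccPoint_eq_phiN (A : Space →ₗᵢ[ℝ] Space) (a : Fin 3 → ℤ) :
    A (fccPoint a) = phiN A 2 (a 0 • ![0, 1, 1] + a 1 • ![1, 0, 1] + a 2 • ![1, 1, 0]) := by
  rw [phiN_apply]
  congr 1
  ext i
  fin_cases i <;> simp [intVec, div_eq_inv_mul]

include h1 h2 h3 h4 in
/-- **Step 2, conclusion**: if the unit neighbours of `z₀ ∈ 𝓛′` are `z₀ + A · Cub`, then every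
lattice point `z₀ + A x`, `x ∈ 𝓛_fcc`, lies in `𝓛′` with unit neighbours `z₀ + A x + A · Cub`.
[cite: FlatleyTheil2015, Proposition 3.1 (proof, "(𝕊 + z) ∩ 𝓛′ = R Cub + t for all z ∈ 𝓛′")] -/
private theorem good_lattice (h35 : FlatleyEtAl2013_maxContacts) {A : Space →ₗᵢ[ℝ] Space}
    {z₀ : Space} (hg : Good L' A z₀) (a : Fin 3 → ℤ) :
    Good L' A (z₀ + A (fccPoint a)) := by
  rw [fccPoint_eq_phiN, map_add, map_add, ← add_assoc, ← add_assoc]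
  obtain ⟨hb1, hb2, hb3⟩ := basis_mem_fccInt
  exact good_zsmul h1 h2 h3 h4 h35
    (good_zsmul h1 h2 h3 h4 h35 (good_zsmul h1 h2 h3 h4 h35 hg hb1 _) hb2 _) hb3 _


/-! ### The covering radius of `𝓛_fcc` is `< 1`, and the conclusion -/

/-- **Every point of `ℝ³` lies within distance `< 1` of `𝓛_fcc`** (unit nearest-neighbour
distance; the covering radius is `1/√2`, here the crude bound `√(3/4)` is proved: round the
coordinates of `√2 · s` to integers and repair the parity of their sum by moving the first
coordinate to the other neighbouring integer). This is what excludes a second, far-away rotated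
copy of `𝓛_fcc` in Proposition 3.1 (hypothesis 1), a point the printed "by induction" leaves
implicit. [cite: FlatleyTheil2015, Proposition 3.1 (proof); our lemma] -/
theorem exists_dist_fccPoint_lt_one (s : Space) : ∃ a : Fin 3 → ℤ, dist s (fccPoint a) < 1 := by
  set p : Fin 3 → ℝ := fun i => Real.sqrt 2 * s i with hp
  set m : Fin 3 → ℤ := fun i => round (p i) with hm
  have hmr : ∀ i, |p i - m i| ≤ 1 / 2 := fun i => abs_sub_round (p i)
  obtain ⟨n, hpar, hn0, hn1, hn2⟩ : ∃ n : Fin 3 → ℤ, Even (n 0 + n 1 + n 2) ∧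
      |p 0 - n 0| ≤ 1 ∧ |p 1 - n 1| ≤ 1 / 2 ∧ |p 2 - n 2| ≤ 1 / 2 := by
    rcases Int.even_or_odd (m 0 + m 1 + m 2) with hev | hodd
    · exact ⟨m, hev, (hmr 0).trans (by norm_num), hmr 1, hmr 2⟩
    · have h0 := hmr 0
      rw [abs_le] at h0
      by_cases hle : (m 0 : ℝ) ≤ p 0
      · refine ⟨![m 0 + 1, m 1, m 2], ?_, ?_, by simpa using hmr 1, by simpa using hmr 2⟩
        · simp only [Matrix.cons_val_zero, Matrix.cons_val_one, Matrix.cons_val_two,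
            Matrix.tail_cons, Matrix.head_cons]
          obtain ⟨k, hk⟩ := hodd
          exact ⟨k + 1, by omega⟩
        · simp only [Matrix.cons_val_zero]
          push_cast
          rw [abs_le]; constructor <;> linarith
      · refine ⟨![m 0 - 1, m 1, m 2], ?_, ?_, by simpa using hmr 1, by simpa using hmr 2⟩
        · simp only [Matrix.cons_val_zero, Matrix.cons_val_one, Matrix.cons_val_two,
            Matrix.tail_cons, Matrix.head_cons]
          obtain ⟨k, hk⟩ := hodd
          exact ⟨k, by omega⟩
        · simp only [Matrix.cons_val_zero]
          push_cast
          rw [abs_le]; constructor <;> linarith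
  obtain ⟨k, hk⟩ := hpar
  refine ⟨![k - n 0, k - n 1, k - n 2], ?_⟩
  have hs2 : Real.sqrt 2 ≠ 0 := by positivity
  have hcoord : ∀ i, s i - fccPoint ![k - n 0, k - n 1, k - n 2] i = (p i - n i) / Real.sqrt 2 := by
    intro i
    fin_cases i
    · simp only [Fin.zero_eta, fccPoint_apply_zero, Matrix.cons_val_one, Matrix.head_cons,
        Matrix.cons_val_two, Matrix.tail_cons, hp]
      push_cast
      field_simp
      have : (k : ℝ) + k = n 0 + n 1 + n 2 := by exact_mod_cast hk.symm
      linarith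
    · simp only [Fin.mk_one, fccPoint_apply_one, Matrix.cons_val_zero, Matrix.cons_val_two,
        Matrix.tail_cons, Matrix.head_cons, hp]
      push_cast
      field_simp
      have : (k : ℝ) + k = n 0 + n 1 + n 2 := by exact_mod_cast hk.symm
      linarith
    · simp only [Fin.reduceFinMk, fccPoint_apply_two, Matrix.cons_val_zero, Matrix.cons_val_one, hp]
      push_cast
      field_simp
      have : (k : ℝ) + k = n 0 + n 1 + n 2 := by exact_mod_cast hk.symm
      linarith
  rw [EuclideanSpace.dist_eq, Real.sqrt_lt' one_pos, Fin.sum_univ_three]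
  simp only [Real.dist_eq, sq_abs, hcoord, div_pow, Real.sq_sqrt (by norm_num : (0:ℝ) ≤ 2)]
  have e0 : (p 0 - n 0) ^ 2 ≤ 1 := by
    rw [abs_le] at hn0; nlinarith
  have e1 : (p 1 - n 1) ^ 2 ≤ 1 / 4 := by
    rw [abs_le] at hn1; nlinarith
  have e2 : (p 2 - n 2) ^ 2 ≤ 1 / 4 := by
    rw [abs_le] at hn2; nlinarith
  linarith

include h1 h2 h3 h4 in
/-- **Flatley–Theil 2015, Proposition 3.1 — lattice form.** Under hypotheses 1–4 of Proposition
3.1 (see `FlatleyTheil2015_prop31`) and Theorem 3.5 (`h35 : FlatleyEtAl2013_maxContacts`), for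
every base point `z₀ ∈ 𝓛′` there is a linear isometry `A` of `ℝ³` with `𝓛′ = z₀ + A 𝓛_fcc`.
(Steps 1–2 give `⊇`; `⊆` is hypothesis 1 with `exists_dist_fccPoint_lt_one`.)
[cite: FlatleyTheil2015, Proposition 3.1 (arXiv p. 9)] -/
theorem eq_image_fccLattice_of_localShells (h35 : FlatleyEtAl2013_maxContacts) {z₀ : Space}
    (hz₀ : z₀ ∈ L') :
    ∃ A : Space →ₗᵢ[ℝ] Space, L' = (fun x => z₀ + A x) '' fccLattice := by
  obtain ⟨A, hA⟩ := nbr_eq_image h1 h2 h3 h4 h35 hz₀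
  have hg : Good L' A z₀ := ⟨hz₀, hA⟩
  refine ⟨A, Set.Subset.antisymm ?_ ?_⟩
  · intro z hz
    have hsurj : Function.Surjective A.toLinearMap :=
      LinearMap.surjective_of_injective A.injective
    obtain ⟨x, hx⟩ := hsurj (z - z₀)
    obtain ⟨a, ha⟩ := exists_dist_fccPoint_lt_one x
    have hmem : z₀ + A (fccPoint a) ∈ L' := (good_lattice h1 h2 h3 h4 h35 hg a).1
    have hd : dist z (z₀ + A (fccPoint a)) < 1 := by
      have : z = z₀ + A x := by rw [LinearIsometry.coe_toLinearMap] at hx; rw [hx]; abel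
      rw [this, dist_add_left, A.dist_map]
      exact ha
    have heq : z = z₀ + A (fccPoint a) := by
      by_contra hne
      exact absurd (h1 z hz _ hmem hne) (not_le.2 hd)
    exact ⟨fccPoint a, ⟨a, rfl⟩, heq.symm⟩
  · rintro _ ⟨x, ⟨a, rfl⟩, rfl⟩
    exact (good_lattice h1 h2 h3 h4 h35 hg a).1

/-- `𝓛_fcc = −𝓛_fcc`. [folklore] -/
private theorem neg_image_fccLattice : (fun x : Space => -x) '' fccLattice = fccLattice := by
  ext x
  simp only [fccLattice, Set.mem_image, Set.mem_range]
  constructor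
  · rintro ⟨_, ⟨a, rfl⟩, rfl⟩; exact ⟨-a, by rw [map_neg]⟩
  · rintro ⟨a, rfl⟩; exact ⟨fccPoint (-a), ⟨-a, rfl⟩, by rw [map_neg, neg_neg]⟩

/-- A linear isometry of `ℝ³` has determinant `±1`. [folklore] -/
private theorem abs_det_linearIsometry (A : Space →ₗᵢ[ℝ] Space) :
    |LinearMap.det A.toLinearMap| = 1 := by
  rw [← LinearMap.normDet_eq_abs_det]
  exact A.normDet_eq_one

include h1 h2 h3 h4 in
/-- The lattice form with `A` orientation preserving (`det A = 1`): if `det A = −1`, replace `A`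
by `A ∘ (−id)`, using `𝓛_fcc = −𝓛_fcc` and `det(−id_{ℝ³}) = −1`.
[cite: FlatleyTheil2015, Proposition 3.1 ("a rotation R ∈ SO(3)")] -/
theorem eq_image_fccLattice_of_localShells_det_one (h35 : FlatleyEtAl2013_maxContacts)
    {z₀ : Space} (hz₀ : z₀ ∈ L') :
    ∃ A : Space →ₗᵢ[ℝ] Space, LinearMap.det A.toLinearMap = 1 ∧
      L' = (fun x => z₀ + A x) '' fccLattice := by
  obtain ⟨A, hA⟩ := eq_image_fccLattice_of_localShells h1 h2 h3 h4 h35 hz₀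
  rcases (abs_eq (zero_le_one' ℝ)).1 (abs_det_linearIsometry A) with hdet | hdet
  · exact ⟨A, hdet, hA⟩
  · refine ⟨A.comp (LinearIsometryEquiv.neg ℝ : Space ≃ₗᵢ[ℝ] Space).toLinearIsometry, ?_, ?_⟩
    · have hneg : ((LinearIsometryEquiv.neg ℝ : Space ≃ₗᵢ[ℝ] Space).toLinearIsometry).toLinearMap =
          (-1 : ℝ) • LinearMap.id := by
        ext x; simp
      have hcomp :
          (A.comp (LinearIsometryEquiv.neg ℝ : Space ≃ₗᵢ[ℝ] Space).toLinearIsometry).toLinearMap =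
            A.toLinearMap.comp
            ((LinearIsometryEquiv.neg ℝ : Space ≃ₗᵢ[ℝ] Space).toLinearIsometry).toLinearMap := rfl
      rw [hcomp, LinearMap.det_comp, hneg, LinearMap.det_smul,
        LinearMap.det_id, hdet, finrank_euclideanSpace_fin]
      norm_num
    · rw [hA, ← neg_image_fccLattice, Set.image_image, neg_image_fccLattice]
      rfl

end Shells

/-- **Flatley–Theil 2015, Proposition 3.1 (local characterisation of the fcc lattice), as
printed.** "Let `𝓛′ ⊂ ℝ³` be a set with the property that for each `z ∈ 𝓛′` 1. `|z − z′| ≥ 1` for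
all `z′ ∈ 𝓛′ ∖ {z}`. 2. There are exactly 12 points `z′ ∈ 𝓛′` such that `|z − z′| = 1`. 3. There
are exactly 48 pairs `z₁, z₂ ∈ 𝓛′` such that `|z₁ − z₂| = |z − zᵢ| = 1` for `i ∈ {1,2}`. 4. There
are exactly 48 pairs `z₁, z₂ ∈ 𝓛′` such that `|z₁ − z₂| = √3` and `|zᵢ − z| = 1` for `i ∈ {1,2}`.
Then there exists a translation `t ∈ ℝ³` and a rotation `R ∈ SO(3)` such that `R 𝓛′ + t = 𝓛_fcc`."
Rendered for NON-EMPTY `𝓛′` (for `𝓛′ = ∅` the printed statement fails, `prop31_needs_nonempty`),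
pairs = ordered pairs, `R` a linear isometry of `ℝ³` of determinant `1`; the printed proof's input
Theorem 3.5 (= Flatley–Tarasov–Taylor–Theil 2013, Thm. 4, computer-assisted) is the hypothesis
`h35`, the tree's named fact `FlatleyEtAl2013_maxContacts`.
[cite: FlatleyTheil2015, Proposition 3.1 (arXiv p. 9), proof via Theorem 3.5] -/
theorem FlatleyTheil2015_prop31 (h35 : FlatleyEtAl2013_maxContacts) {L' : Set Space}
    (hne : L'.Nonempty) (h1 : ∀ z ∈ L', ∀ z' ∈ L', z ≠ z' → 1 ≤ dist z z')
    (h2 : ∀ z ∈ L', {z' | z' ∈ L' ∧ dist z z' = 1}.ncard = 12)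
    (h3 : ∀ z ∈ L', {p : Space × Space | p.1 ∈ L' ∧ p.2 ∈ L' ∧ dist p.1 p.2 = 1 ∧
      dist z p.1 = 1 ∧ dist z p.2 = 1}.ncard = 48)
    (h4 : ∀ z ∈ L', {p : Space × Space | p.1 ∈ L' ∧ p.2 ∈ L' ∧ dist p.1 p.2 = Real.sqrt 3 ∧
      dist z p.1 = 1 ∧ dist z p.2 = 1}.ncard = 48) :
    ∃ (R : Space ≃ₗᵢ[ℝ] Space) (t : Space),
      LinearMap.det (R.toLinearEquiv : Space →ₗ[ℝ] Space) = 1 ∧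
        (fun z => R z + t) '' L' = fccLattice := by
  obtain ⟨z₀, hz₀⟩ := hne
  obtain ⟨A, hdet, hA⟩ := eq_image_fccLattice_of_localShells_det_one h1 h2 h3 h4 h35 hz₀
  set Ae : Space ≃ₗᵢ[ℝ] Space := A.toLinearIsometryEquiv rfl with hAe
  have hAe_apply : ∀ x, Ae x = A x := fun x => rfl
  have hcoe : (Ae.toLinearEquiv : Space →ₗ[ℝ] Space) = A.toLinearMap := by
    ext x; rfl
  refine ⟨Ae.symm, -Ae.symm z₀, ?_, ?_⟩
  · have : (Ae.symm.toLinearEquiv : Space →ₗ[ℝ] Space) =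
        ((Ae.toLinearEquiv).symm : Space →ₗ[ℝ] Space) := rfl
    rw [this, LinearEquiv.det_coe_symm, hcoe, hdet, inv_one]
  · rw [hA, Set.image_image]
    convert Set.image_id fccLattice using 2 with x
    simp only [id]
    rw [← hAe_apply, map_add, LinearIsometryEquiv.symm_apply_apply]
    abel


/-- **Print note**: the non-emptiness hypothesis of `FlatleyTheil2015_prop31` cannot be dropped —
for `𝓛′ = ∅` hypotheses 1–4 hold vacuously while `R ∅ + t = ∅ ≠ 𝓛_fcc`.
[cite: FlatleyTheil2015, Proposition 3.1 (statement); our remark] -/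
theorem prop31_needs_nonempty (R : Space ≃ₗᵢ[ℝ] Space) (t : Space) :
    (fun z => R z + t) '' (∅ : Set Space) ≠ fccLattice := by
  rw [Set.image_empty]
  intro h
  have : (fccPoint 0 : Space) ∈ fccLattice := ⟨0, rfl⟩
  rw [← h] at this
  exact this

/-! ### Non-vacuity: `𝓛_fcc` itself satisfies hypotheses 1–4 -/

/-- Integer vectors of squared norm `2` are exactly the twelve minimal vectors of `D₃`.
[cite: ConwaySloane1999, Ch. 4 §6.3 (minimal vectors of `D₃`)] -/
private theorem mem_fccInt_of_sqNormInt_eq_two {v : Fin 3 → ℤ} (hv : sqNormInt v = 2) :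
    v ∈ fccInt := by
  unfold sqNormInt at hv
  have h0 : v 0 ≤ 1 ∧ -1 ≤ v 0 := by
    constructor <;>
      nlinarith [sq_nonneg (v 1), sq_nonneg (v 2), sq_nonneg (v 0 - 1), sq_nonneg (v 0 + 1)]
  have h1 : v 1 ≤ 1 ∧ -1 ≤ v 1 := by
    constructor <;>
      nlinarith [sq_nonneg (v 0), sq_nonneg (v 2), sq_nonneg (v 1 - 1), sq_nonneg (v 1 + 1)]
  have h2 : v 2 ≤ 1 ∧ -1 ≤ v 2 := by
    constructor <;>
      nlinarith [sq_nonneg (v 0), sq_nonneg (v 1), sq_nonneg (v 2 - 1), sq_nonneg (v 2 + 1)]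
  have hv' : v = ![v 0, v 1, v 2] := by
    funext i; fin_cases i <;> rfl
  obtain ⟨h0a, h0b⟩ := h0
  obtain ⟨h1a, h1b⟩ := h1
  obtain ⟨h2a, h2b⟩ := h2
  rw [hv']
  interval_cases h : v 0 <;> interval_cases h' : v 1 <;> interval_cases h'' : v 2 <;>
    first | (exfalso; omega) | decide

/-- The `D₃` coordinates `(a₂+a₃, a₁+a₃, a₁+a₂)` of the label `a`. [folklore] -/
private def dThree (a : Fin 3 → ℤ) : Fin 3 → ℤ := ![a 1 + a 2, a 0 + a 2, a 0 + a 1]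

/-- `fccPoint a = dThree a / √2`. [folklore] -/
private theorem fccPoint_eq_dThree (a : Fin 3 → ℤ) :
    fccPoint a = (Real.sqrt 2)⁻¹ • intVec (dThree a) := by
  ext i
  fin_cases i <;> simp [intVec, dThree, div_eq_inv_mul]

/-- `‖fccPoint a‖² = |dThree a|²/2`. [folklore] -/
private theorem norm_fccPoint_sq' (a : Fin 3 → ℤ) :
    ‖fccPoint a‖ ^ 2 = (sqNormInt (dThree a) : ℝ) / 2 := by
  rw [norm_fccPoint_sq]
  simp [sqNormInt, dThree]

/-- Twelve labels whose `D₃` coordinates run through `fccInt`. [folklore] -/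
private def twelveLabels : Finset (Fin 3 → ℤ) :=
  {![1, 0, 0], ![0, 1, 0], ![0, 0, 1], ![-1, 0, 0], ![0, -1, 0], ![0, 0, -1],
   ![1, -1, 0], ![-1, 1, 0], ![1, 0, -1], ![-1, 0, 1], ![0, 1, -1], ![0, -1, 1]}

/-- Every minimal vector of `D₃` is the `D₃` coordinate vector of one of the twelve labels.
[folklore] -/
private theorem exists_label_of_mem_fccInt : ∀ v ∈ fccInt, ∃ c ∈ twelveLabels, dThree c = v := by
  decide

/-- `𝓛_fcc` is `1`-separated: a non-zero vector of `D₃` has squared norm `≥ 2`.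
[cite: FlatleyTheil2015, Proposition 3.1 (1) for 𝓛′ = 𝓛_fcc; §2.1 (lattice parameter 1)] -/
theorem one_le_dist_fccLattice {z z' : Space} (hz : z ∈ fccLattice) (hz' : z' ∈ fccLattice)
    (hne : z ≠ z') : 1 ≤ dist z z' := by
  obtain ⟨a, rfl⟩ := hz
  obtain ⟨b, rfl⟩ := hz'
  rw [dist_eq_norm, ← map_sub]
  set c := a - b with hc
  have hc0 : c ≠ 0 := by
    intro h
    apply hne
    have : a = b := sub_eq_zero.1 (hc ▸ h)
    rw [this]
  have hsq : (1 : ℝ) ≤ ‖fccPoint c‖ ^ 2 := by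
    rw [norm_fccPoint_sq]
    have hT : (2 : ℤ) ≤ (c 1 + c 2) ^ 2 + (c 0 + c 2) ^ 2 + (c 0 + c 1) ^ 2 := by
      have h2T : (c 1 + c 2) ^ 2 + (c 0 + c 2) ^ 2 + (c 0 + c 1) ^ 2 =
          2 * (c 0 ^ 2 + c 1 ^ 2 + c 2 ^ 2 + c 0 * c 1 + c 0 * c 2 + c 1 * c 2) := by ring
      have hpos : 0 < c 0 ^ 2 + c 1 ^ 2 + c 2 ^ 2 + c 0 * c 1 + c 0 * c 2 + c 1 * c 2 := by
        have hsum : 2 * (c 0 ^ 2 + c 1 ^ 2 + c 2 ^ 2 + c 0 * c 1 + c 0 * c 2 + c 1 * c 2) =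
            (c 0 + c 1 + c 2) ^ 2 + (c 0 ^ 2 + c 1 ^ 2 + c 2 ^ 2) := by ring
        have hne' : c 0 ≠ 0 ∨ c 1 ≠ 0 ∨ c 2 ≠ 0 := by
          by_contra h
          simp only [not_or, not_not] at h
          exact hc0 (by funext i; fin_cases i <;> simp [h.1, h.2.1, h.2.2])
        have hsq0 : 0 < c 0 ^ 2 + c 1 ^ 2 + c 2 ^ 2 := by
          rcases hne' with h | h | h <;> nlinarith [sq_nonneg (c 0), sq_nonneg (c 1),
            sq_nonneg (c 2), sq_pos_of_ne_zero h]
        nlinarith [sq_nonneg (c 0 + c 1 + c 2)]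
      omega
    have h2 : (2 : ℝ) ≤ (((c 1 + c 2) ^ 2 + (c 0 + c 2) ^ 2 + (c 0 + c 1) ^ 2 : ℤ) : ℝ) := by
      exact_mod_cast hT
    linarith
  nlinarith [norm_nonneg (fccPoint c)]

/-- The unit neighbours of a point `z₀ ∈ 𝓛_fcc` are `z₀ + Cub`.
[cite: FlatleyTheil2015, §3.1.1 ("Cub := 𝓛_fcc ∩ 𝕊")] -/
theorem nbr_fccLattice_eq (a : Fin 3 → ℤ) :
    nbr fccLattice (fccPoint a) = (fun x => fccPoint a + x) '' ↑fccKissingPattern := by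
  ext x
  simp only [nbr, Set.mem_setOf_eq, Set.mem_image, Finset.mem_coe, fccKissingPattern,
    scaledPattern, Finset.mem_image]
  constructor
  · rintro ⟨⟨b, rfl⟩, hd⟩
    rw [dist_eq_norm', ← map_sub] at hd
    have hsq : sqNormInt (dThree (b - a)) = 2 := by
      have h := norm_fccPoint_sq' (b - a)
      rw [hd, one_pow] at h
      have : (sqNormInt (dThree (b - a)) : ℝ) = 2 := by linarith
      exact_mod_cast this
    refine ⟨(Real.sqrt 2)⁻¹ • intVec (dThree (b - a)), ⟨dThree (b - a),
      mem_fccInt_of_sqNormInt_eq_two hsq, rfl⟩, ?_⟩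
    rw [← fccPoint_eq_dThree, map_sub, add_sub_cancel]
  · rintro ⟨_, ⟨v, hv, rfl⟩, rfl⟩
    obtain ⟨c, -, hcv⟩ := exists_label_of_mem_fccInt v hv
    refine ⟨⟨a + c, by rw [map_add, fccPoint_eq_dThree c, hcv]; rfl⟩, ?_⟩
    rw [dist_eq_norm', add_sub_cancel_left, norm_smul, norm_inv,
      Real.norm_of_nonneg (Real.sqrt_nonneg _), norm_intVec, sqNormInt_fccInt v hv]
    push_cast
    rw [inv_mul_cancel₀ (by positivity)]

/-- Ordered vertex pairs of the cuboctahedron at unit distance: `48` (integer model).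
[cite: FlatleyTheil2015, §3.1.1 ("twenty-four edges")] -/
private theorem card_fccInt_unit :
    ((fccInt ×ˢ fccInt).filter fun p => sqNormInt (p.1 - p.2) = 2).card = 48 := by
  decide

/-- Ordered vertex pairs of the cuboctahedron at distance `√3`: `48` (integer model, squared
distance `6`). [cite: FlatleyTheil2015, Proposition 3.1 (4)] -/
private theorem card_fccInt_six :
    ((fccInt ×ˢ fccInt).filter fun p => sqNormInt (p.1 - p.2) = 6).card = 48 := by
  decide

/-- Pair counts in the shell of a lattice point, reduced to the integer model. [folklore] -/
private theorem ncard_pairs_fccLattice (a : Fin 3 → ℤ) {d : ℝ} (hd : 0 ≤ d) (m : ℤ)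
    (hm : (m : ℝ) = 2 * d ^ 2) :
    {p : Space × Space | p.1 ∈ fccLattice ∧ p.2 ∈ fccLattice ∧ dist p.1 p.2 = d ∧
        dist (fccPoint a) p.1 = 1 ∧ dist (fccPoint a) p.2 = 1}.ncard =
      ((fccInt ×ˢ fccInt).filter fun p => sqNormInt (p.1 - p.2) = m).card := by
  classical
  have hfin : (nbr fccLattice (fccPoint a)).Finite := by
    rw [nbr_fccLattice_eq]; exact (fccKissingPattern.finite_toSet).image _
  have hshell : shell fccLattice (fccPoint a) hfin = fccKissingPattern := by
    ext x
    rw [mem_shell]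
    change fccPoint a + x ∈ nbr fccLattice (fccPoint a) ↔ _
    rw [nbr_fccLattice_eq]
    simp only [Set.mem_image, Finset.mem_coe, add_right_inj, exists_eq_right]
  have hpat : fccKissingPattern =
      fccInt.image (phiN (LinearIsometry.id : Space →ₗᵢ[ℝ] Space) 2) := by
    rw [← image_scaledPattern, LinearIsometry.coe_id, Finset.image_id]
    rfl
  rw [← card_shell_pairs hfin d, hshell, hpat,
    card_filter_dist_image LinearIsometry.id fccInt (by norm_num) hd]
  congr 1
  refine Finset.filter_congr fun p _ => ?_
  push_cast
  rw [← hm]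
  norm_cast

/-- **Non-vacuity of Proposition 3.1: the fcc lattice itself satisfies hypotheses 1–4** (it is
non-empty, `1`-separated, every point has exactly twelve unit neighbours, with `48` ordered unit
pairs and `48` ordered `√3`-pairs among them). So `FlatleyTheil2015_prop31` is not vacuously
true, and its hypotheses describe `𝓛_fcc` exactly (up to rigid motions).
[cite: FlatleyTheil2015, Proposition 3.1 with §3.1.1 ("twelve vertices, twenty-four edges")] -/
theorem fccLattice_prop31_hypotheses :
    fccLattice.Nonempty ∧
    (∀ z ∈ fccLattice, ∀ z' ∈ fccLattice, z ≠ z' → 1 ≤ dist z z') ∧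
    (∀ z ∈ fccLattice, {z' | z' ∈ fccLattice ∧ dist z z' = 1}.ncard = 12) ∧
    (∀ z ∈ fccLattice, {p : Space × Space | p.1 ∈ fccLattice ∧ p.2 ∈ fccLattice ∧
      dist p.1 p.2 = 1 ∧ dist z p.1 = 1 ∧ dist z p.2 = 1}.ncard = 48) ∧
    (∀ z ∈ fccLattice, {p : Space × Space | p.1 ∈ fccLattice ∧ p.2 ∈ fccLattice ∧
      dist p.1 p.2 = Real.sqrt 3 ∧ dist z p.1 = 1 ∧ dist z p.2 = 1}.ncard = 48) := by
  refine ⟨⟨fccPoint 0, 0, rfl⟩, fun z hz z' hz' hne => one_le_dist_fccLattice hz hz' hne,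
    ?_, ?_, ?_⟩
  · rintro _ ⟨a, rfl⟩
    change (nbr fccLattice (fccPoint a)).ncard = 12
    rw [nbr_fccLattice_eq, Set.ncard_image_of_injective _ (add_right_injective _),
      Set.ncard_coe_finset, card_fccKissingPattern]
  · rintro _ ⟨a, rfl⟩
    rw [ncard_pairs_fccLattice a zero_le_one 2 (by norm_num), card_fccInt_unit]
  · rintro _ ⟨a, rfl⟩
    rw [ncard_pairs_fccLattice a (Real.sqrt_nonneg 3) 6
      (by rw [Real.sq_sqrt (by norm_num : (0:ℝ) ≤ 3)]; norm_num), card_fccInt_six]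

#harness_tags FlatleyTheil2015_prop31
#harness_tags eq_image_fccLattice_of_localShells
#harness_tags fccLattice_prop31_hypotheses

end Literature.MathematicalPhysics.StatisticalMechanics.FlatleyTheil2015
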